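import Summits.Ventures.LatticeQCDFlow.Scaling.TaggedStartContentResidualG
import Summits.Ventures.LatticeQCDFlow.Scaling.TaggedStartContentAboveGlobal
import Summits.Ventures.LatticeQCDFlow.Scaling.TaggedLoneBetweenBudget
import Summits.Ventures.LatticeQCDFlow.Scaling.StarOccupationComparison
import Summits.Ventures.LatticeQCDFlow.Scaling.TaggedDomination

/-!
HONEST FRAMING: exact (Metropolis-corrected) sampling algorithms for lattice gauge theory; figures
of merit are autocorrelation/cost numbers at stated couplings and volumes; no continuum-physics
claim.

# TaggedPerAttemptCertificateLoneBetween — CONJECTURE W′ FOR THE LONE HUB STRICTLY BETWEEN THE EXTRA PARTICLES (`W_b ≤ W_z < W_a`, `N_C(z) = 1`, EVERY OTHER PRESENT CONTENT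
# STRICTLY BELOW `W_z`), `K ≥ 3`: THE SIGNED SUM OF THE RESIDUAL `g`-FORM AND THE HUB-ABOVE BOUND THROUGH THE TAG POSITION AT `W_z` (lean-2 GEN-42, ours)

Venture-side (OURS).  Cell `lqcd-flow` (pub-lqcd), unit `pub-lqcd-lean-2-g42`, 2026-08-30.  Chapter AB (route (β), the cost side continued), file 16 — the configuration excluded by
file 13, for `K ≥ 3`.  With `Z` = the tag AT `W_z` (chain built inside the proof): `e^{XY}_n = e^{XZ}_n + e^{ZY}_n` EXACTLY; `(X,Z)` is the residual pair with `α_Z = 1`, so file 15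
gives the SIGNED `e^{XZ}_n ≤ cⁿ(g_n(1) − g_n(α))` (`= cⁿ(α(1+αⁿ)/(1+α) − 1) ≤ cⁿ(α − 1)` at odd `n`, `≤ cⁿα/(1+α)` at even `n`), and `(Z,Y)` is a lone hub at the upper tag, so file 9
gives `e^{ZY}_n ≤ cⁿ/2` at odd `n ≥ 3`, `≤ 0` otherwise.  Hence `e⁺_n ≤ cⁿα/(1+α)` at even `n`, `≤ cⁿ(2α−1)⁺/2` at odd `n ≥ 3`, `e_1 ≤ 0`; the budget is the residual one plus
`(1−σ)((2α−1)⁺/2)c(σc)²/(1−σ²c²) ≤ (σ/K)·(residual budget)` (`(2α−1)⁺(1+α) ≤ 2α`), the factor `1+σ/K` cancels `K+σ`, and files 7a's income pays for `K ≥ 3`: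
`(4K+2)σ(K+σα) ≤ K²[(2K−1)(1+α)+σ(1−α)]` (`≥ (2K³−4K²−2K) + α(2K³−2K²−4K−2)`).  At `K = 2` the crude forms miss the corner `α, σ → 1` (toy `lone_between_scalar.py`: ratio 0.80 at
`K = 2`, 1.61 at `K = 3`), where the true deficit vanishes — `K = 2` here stays open.

* **`tagged_costSide_loneBetween`** (`L·D_J ≤ 2s1`, `0 ≤ L ≤ 4K+2`; budget: file 15b `loneBetween_budget`; income: file 15b `tagged_residual_income`; scalar: file 7a
  `costSide_scalar_loneBetween`), **`tagged_perAttempt_certificate_loneBetween`** (Conjecture W′).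

With file 13: Conjecture W′ on EVERY adjacent edge from EVERY ordinary hub for every `K ≥ 3` (file 17); for `K = 2` up to this configuration.  Literature grade (cell rule): OWN; nothing cited;
no new bib keys.
-/

open Finset

namespace Summit.Ventures.LatticeQCDFlow.Scaling

/-! ### §2 The cost side and Conjecture W′ for the lone hub strictly between, `K ≥ 3` -/
section LoneBetween
variable {S : Type*} [Fintype S] [DecidableEq S]
variable {W θ : S → ℝ} {acc : S → S → ℝ} {p : ℝ} {K : ℕ} {NC : S → ℕ} {a b : S} {PX PY : Option S → Option S → ℝ}

/-- **THE COST-SIDE INEQUALITY FOR THE LONE HUB STRICTLY BETWEEN THE EXTRA PARTICLES, `K ≥ 3`:** `L·D_J ≤ 2s1` for every `0 ≤ L ≤ 4K+2`. [ours] -/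
theorem tagged_costSide_loneBetween (hW : ∀ v, 0 < W v) (hp0 : 0 ≤ p) (hp : ∀ v, p * W v ≤ 1) (hθ : ∀ v, θ v = 1 / (1 + p * W v))
    (hacc : ∀ h v, acc h v = min 1 (W h / W v)) (hK : 3 ≤ K) (hNC : ∑ v, NC v = K)
    (hPXoff : ∀ h v, h ≠ v → PX (some h) (some v) = if NC h = 0 then 0 else (NC v : ℝ) / K * acc h v)
    (hPXin : ∀ h, PX (some h) none = if NC h = 0 then 0 else acc h a / K)
    (hPXdiag : ∀ h, PX (some h) (some h) = 1 - (∑ v ∈ univ.erase h, PX (some h) (some v) + PX (some h) none))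
    (hPXout : ∀ v, PX none (some v) = (NC v : ℝ) / K * acc a v) (hPXstay : PX none none = 1 - ∑ v, PX none (some v))
    (hPYoff : ∀ h v, h ≠ v → PY (some h) (some v) = if NC h = 0 then 0 else (NC v : ℝ) / K * acc h v)
    (hPYin : ∀ h, PY (some h) none = if NC h = 0 then 0 else acc h b / K)
    (hPYdiag : ∀ h, PY (some h) (some h) = 1 - (∑ v ∈ univ.erase h, PY (some h) (some v) + PY (some h) none))
    (hPYout : ∀ v, PY none (some v) = (NC v : ℝ) / K * acc b v) (hPYstay : PY none none = 1 - ∑ v, PY none (some v))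
    {z : S} (hz1 : NC z = 1) (hbz : W b ≤ W z) (hza : W z < W a) (hbelow : ∀ w, w ≠ z → NC w ≠ 0 → W w < W z)
    {x y : ℕ → Option S → ℝ}
    (hx0 : ∀ v, x 0 v = if v = some z then 1 else 0) (hxs : ∀ n v, x (n + 1) v = ∑ h, x n h * PX h v)
    (hy0 : ∀ v, y 0 v = if v = some z then 1 else 0) (hys : ∀ n v, y (n + 1) v = ∑ h, y n h * PY h v)
    {M : ℝ} (hM : M = ∑ v, θ v * (NC v : ℝ) + θ a) {L : ℝ} (hL0 : 0 ≤ L) (hL4 : L ≤ 4 * K + 2)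
    {σ : ℝ} (hσ0 : 0 ≤ σ) (hσ1 : σ < 1) {ut : Option S → ℝ} (hut : ∀ t, ut t = (1 - σ) * PX (some z) t + σ * ∑ t', ut t' * PX t' t) (J : ℕ) :
    L * ∑ n ∈ range J, (1 - σ) * σ ^ n * max 0 (y (n + 1) (some z) - x (n + 1) (some z))
      ≤ 2 * ((K + M) * ut none - (∑ v, ut (some v) * (1 - θ v) + ut none * (1 - θ a))) := by
  have hz : NC z ≠ 0 := by rw [hz1]; exact one_ne_zero
  have hK2 : 2 ≤ K := by omega
  have hK1 : 1 ≤ K := by omega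
  have hK0 : (0 : ℝ) < K := by exact_mod_cast (show 0 < K by omega)
  have hK3r : (3 : ℝ) ≤ K := by exact_mod_cast hK
  have hθm := theta_mem hW hp0 hp hθ
  -- the intermediate tagged chain `P_Z` (tag content `z`) and its laws `ζ_n` (verbatim from file 12)
  classical
  obtain ⟨offZ, hoffZ⟩ : ∃ off : S → S → ℝ, ∀ h v, off h v = if NC h = 0 then 0 else (NC v : ℝ) / K * acc h v := ⟨_, fun _ _ => rfl⟩
  obtain ⟨inZ, hinZ⟩ : ∃ f : S → ℝ, ∀ h, f h = if NC h = 0 then 0 else acc h z / K := ⟨_, fun _ => rfl⟩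
  obtain ⟨outZ, houtZ⟩ : ∃ f : S → ℝ, ∀ v, f v = (NC v : ℝ) / K * acc z v := ⟨_, fun _ => rfl⟩
  obtain ⟨PZ, hPZ⟩ : ∃ PZ : Option S → Option S → ℝ, ∀ s t, PZ s t =
      Option.elim s (Option.elim t (1 - ∑ v, outZ v) (fun v => outZ v))
        (fun h => Option.elim t (inZ h) (fun v => if h = v then 1 - (∑ v' ∈ univ.erase h, offZ h v' + inZ h) else offZ h v)) := ⟨_, fun _ _ => rfl⟩
  have hPZoff : ∀ h v, h ≠ v → PZ (some h) (some v) = if NC h = 0 then 0 else (NC v : ℝ) / K * acc h v := fun h v hhv => by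
    rw [hPZ]; simp only [Option.elim]; rw [if_neg hhv, hoffZ]
  have hPZin : ∀ h, PZ (some h) none = if NC h = 0 then 0 else acc h z / K := fun h => by rw [hPZ]; simp only [Option.elim]; rw [hinZ]
  have hPZdiag : ∀ h, PZ (some h) (some h) = 1 - (∑ v ∈ univ.erase h, PZ (some h) (some v) + PZ (some h) none) := fun h => by
    rw [hPZ]; simp only [Option.elim, if_true]; rw [hPZin, hinZ]
    congr 2
    exact sum_congr rfl fun v hv => by rw [hPZoff h v (ne_of_mem_erase hv).symm, hoffZ]
  have hPZout : ∀ v, PZ none (some v) = (NC v : ℝ) / K * acc z v := fun v => by rw [hPZ]; simp only [Option.elim]; rw [houtZ]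
  have hPZstay : PZ none none = 1 - ∑ v, PZ none (some v) := by
    rw [hPZ]; simp only [Option.elim]; congr 1; exact sum_congr rfl fun v _ => by rw [hPZout, houtZ]
  let ζ : ℕ → Option S → ℝ := fun n => Nat.rec (motive := fun _ => Option S → ℝ) (fun v => if v = some z then 1 else 0) (fun _ prev v => ∑ h, prev h * PZ h v) n
  have hζ0 : ∀ v, ζ 0 v = if v = some z then 1 else 0 := fun _ => rfl
  have hζs : ∀ n v, ζ (n + 1) v = ∑ h, ζ n h * PZ h v := fun _ _ => rfl
  -- the upper half-move `(X,Z)`: the residual pair with `b := z`, SIGNED `g`-form (file 15); the lower half-move `(Z,Y)`: the lone hub at the upper tag (file 9 (ii),(iii))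
  have hg := tagged_startClass_residual_g hW hacc hK2 hNC hza.le hPXoff hPXin hPXdiag hPXout hPXstay hPZoff hPZin hPZdiag hPZout hPZstay
    hz1 le_rfl hza hbelow hx0 hxs hζ0 hζs (b := z)
  obtain ⟨-, hBzy, hOzy, -⟩ := tagged_startClass_above_global hW hacc hK2 hNC hbz hPZoff hPZin hPZdiag hPZout hPZstay hPYoff hPYin hPYdiag hPYout hPYstay
    hz le_rfl hζ0 hζs hy0 hys (a := z)
  -- `α = W_z/W_a`, `c = 1/K`
  have hα0 : 0 ≤ W z / W a := div_nonneg (hW z).le (hW a).le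
  have hα1 : W z / W a ≤ 1 := (div_le_one (hW a)).mpr hza.le
  have hc0 : 0 ≤ 1 / (K : ℝ) := by positivity
  have hc3 : 1 / (K : ℝ) ≤ 1 / 3 := one_div_le_one_div_of_le (by norm_num) hK3r
  have hσc : σ * (1 / (K : ℝ)) < 1 := by nlinarith
  have hzz : W z / W z = 1 := div_self (hW z).ne'
  have hg' : ∀ n, ζ n (some z) - x n (some z)
      ≤ (1 / (K : ℝ)) ^ n * ((-(1:ℝ) - (-(1:ℝ)) ^ (n + 1)) / (1 + 1) - (-(W z / W a) - (-(W z / W a)) ^ (n + 1)) / (1 + W z / W a)) := by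
    intro n; have h := hg n; rwa [hzz] at h
  have hB' : ∀ n, y (n + 1) (some z) - ζ (n + 1) (some z) ≤ if Even n then (1 / (K : ℝ)) ^ (n + 1) / 2 else 0 := hBzy
  -- the budget (file 15b §1) and the income (file 15b §2)
  have hbud := loneBetween_budget (xz := fun n => x n (some z)) (yz := fun n => y n (some z)) (ζz := fun n => ζ n (some z))
    hα0 hα1 hc0 hσ0 hσ1.le hσc hg' hB' hOzy J
  have hs1 := tagged_residual_income hW hp0 hp hθ hacc hK2 hNC hPXoff hPXin hPXdiag hPXout hPXstay hz1 hza hbelow hM hσ0 hσ1 hut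
  -- the scalar inequality (`K ≥ 3`, file 7a §3) and the chain
  have hscal := costSide_scalar_loneBetween hK3r hL4 hL0 hα0 hα1 (hθm a).1 hσ0 hσ1.le (K := (K : ℝ)) (α := W z / W a) (σ := σ)
  have hdet : 0 < (1 - σ / K) * (1 + σ * (W z / W a) / K) := by
    have h1 : 0 < 1 - σ / (K : ℝ) := by
      have : σ / (K : ℝ) ≤ 1 / 3 := by rw [div_le_iff₀ hK0]; linarith
      linarith
    have h2 : 0 < 1 + σ * (W z / W a) / K := by
      have : 0 ≤ σ * (W z / W a) / K := by positivity
      linarith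
    exact mul_pos h1 h2
  calc L * ∑ n ∈ range J, (1 - σ) * σ ^ n * max 0 (y (n + 1) (some z) - x (n + 1) (some z))
      ≤ L * ((1 - σ) * ((W z / W a / (1 + W z / W a) * (1 / (K : ℝ))) * (σ * (1 / (K : ℝ)) / (1 - (σ * (1 / (K : ℝ))) ^ 2))
          + (max 0 (2 * (W z / W a) - 1) / 2 * (1 / (K : ℝ))) * ((σ * (1 / (K : ℝ))) ^ 2 / (1 - (σ * (1 / (K : ℝ))) ^ 2)))) :=
        mul_le_mul_of_nonneg_left hbud hL0
    _ = (1 - σ) * (L * ((W z / W a / (1 + W z / W a)) * (1 / (K : ℝ)) * (σ * (1 / (K : ℝ)) / (1 - (σ * (1 / (K : ℝ))) ^ 2))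
          + (max 0 (2 * (W z / W a) - 1) / 2) * (1 / (K : ℝ)) * ((σ * (1 / (K : ℝ))) ^ 2 / (1 - (σ * (1 / (K : ℝ))) ^ 2)))) := by ring
    _ ≤ (1 - σ) * (2 * ((W z / W a * ((K : ℝ) - 2 + 3 * θ a) / K + σ * (W z / W a / K) * ((1 - W z / W a) * (1 - θ a) / (1 + W z / W a)))
          / ((1 - σ / K) * (1 + σ * (W z / W a) / K)))) := mul_le_mul_of_nonneg_left hscal (by linarith only [hσ1])
    _ = 2 * ((1 - σ) * (W z / W a * ((K : ℝ) - 2 + 3 * θ a) / K + σ * (W z / W a / K) * ((1 - W z / W a) * (1 - θ a) / (1 + W z / W a)))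
          / ((1 - σ / K) * (1 + σ * (W z / W a) / K))) := by
        field_simp
    _ ≤ 2 * ((K + M) * ut none - (∑ v, ut (some v) * (1 - θ v) + ut none * (1 - θ a))) := mul_le_mul_of_nonneg_left hs1 (by norm_num)

/-- **CONJECTURE W′ FOR THE LONE HUB STRICTLY BETWEEN THE EXTRA PARTICLES, `K ≥ 3`:** `cost(x̃) + cost(ỹ) ≤ L·(x̃(★) + (x̃(a) − ỹ(a)) − D_J)` for every `J`. [ours] -/
theorem tagged_perAttempt_certificate_loneBetween (hW : ∀ v, 0 < W v) (hp0 : 0 ≤ p) (hp : ∀ v, p * W v ≤ 1) (hθ : ∀ v, θ v = 1 / (1 + p * W v))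
    (hacc : ∀ h v, acc h v = min 1 (W h / W v)) (hK : 3 ≤ K) (hNC : ∑ v, NC v = K) (hab : W b ≤ W a)
    (hPXoff : ∀ h v, h ≠ v → PX (some h) (some v) = if NC h = 0 then 0 else (NC v : ℝ) / K * acc h v)
    (hPXin : ∀ h, PX (some h) none = if NC h = 0 then 0 else acc h a / K)
    (hPXdiag : ∀ h, PX (some h) (some h) = 1 - (∑ v ∈ univ.erase h, PX (some h) (some v) + PX (some h) none))
    (hPXout : ∀ v, PX none (some v) = (NC v : ℝ) / K * acc a v) (hPXstay : PX none none = 1 - ∑ v, PX none (some v))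
    (hPYoff : ∀ h v, h ≠ v → PY (some h) (some v) = if NC h = 0 then 0 else (NC v : ℝ) / K * acc h v)
    (hPYin : ∀ h, PY (some h) none = if NC h = 0 then 0 else acc h b / K)
    (hPYdiag : ∀ h, PY (some h) (some h) = 1 - (∑ v ∈ univ.erase h, PY (some h) (some v) + PY (some h) none))
    (hPYout : ∀ v, PY none (some v) = (NC v : ℝ) / K * acc b v) (hPYstay : PY none none = 1 - ∑ v, PY none (some v))
    {z : S} (hz1 : NC z = 1) (hbz : W b ≤ W z) (hza : W z < W a) (hbelow : ∀ w, w ≠ z → NC w ≠ 0 → W w < W z)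
    {x y : ℕ → Option S → ℝ}
    (hx0 : ∀ v, x 0 v = if v = some z then 1 else 0) (hxs : ∀ n v, x (n + 1) v = ∑ h, x n h * PX h v)
    (hy0 : ∀ v, y 0 v = if v = some z then 1 else 0) (hys : ∀ n v, y (n + 1) v = ∑ h, y n h * PY h v)
    {M : ℝ} (hM : M = ∑ v, θ v * (NC v : ℝ) + θ a) {L : ℝ} (hL : L = 2 * K + M + (∑ v, θ v * (NC v : ℝ) + θ b))
    {σ : ℝ} (hσ0 : 0 ≤ σ) (hσ1 : σ < 1) {xt yt xs ys : Option S → ℝ}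
    (hxt : ∀ t, xt t = (1 - σ) * PX (some z) t + σ * ∑ t', xt t' * PX t' t) (hyt : ∀ t, yt t = (1 - σ) * PY (some z) t + σ * ∑ t', yt t' * PY t' t)
    (hxsr : ∀ t, xs t = (1 - σ) * PX none t + σ * ∑ t', xs t' * PX t' t) (hysr : ∀ t, ys t = (1 - σ) * PY none t + σ * ∑ t', ys t' * PY t' t) (J : ℕ) :
    (∑ v, xt (some v) * (1 - θ v) + xt none * (1 - θ a)) + (∑ v, yt (some v) * (1 - θ v) + yt none * (1 - θ b))
      ≤ L * (xt none + (xt (some a) - yt (some a)) - ∑ n ∈ range J, (1 - σ) * σ ^ n * max 0 (y (n + 1) (some z) - x (n + 1) (some z))) := by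
  have hz : NC z ≠ 0 := by rw [hz1]; exact one_ne_zero
  have hK1 : 1 ≤ K := by omega
  have hK0r : (0 : ℝ) ≤ K := Nat.cast_nonneg _
  have hθm := theta_mem hW hp0 hp hθ
  have hMY : (∑ v, θ v * (NC v : ℝ) + θ b) = M + (θ b - θ a) := by rw [hM]; ring
  have hdec := ledger_perStep_eq (θ := θ) (x := xt) (y := yt) (z := z) (a := a)
    (pen := ∑ n ∈ range J, (1 - σ) * σ ^ n * max 0 (y (n + 1) (some z) - x (n + 1) (some z))) hMY hL
  have hDstar := tagged_star_domination hW hacc hK1 hNC hab hPXoff hPXin hPXdiag hPXout hPXstay hPYoff hPYin hPYdiag hPYout hPYstay hσ0 hσ1 hxsr hysr z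
  have hs3 := S2_of_star_domination hW hp0 hp hθ hacc hK1 hNC hab hPXoff hPXin hPXdiag hPXout hPXstay hPYoff hPYin hPYout hσ0 hσ1 hz hxt hyt hxsr hysr hDstar
  have hdom := tagged_hub_domination hW hacc hK1 hNC hab hPXoff hPXin hPXdiag hPXout hPXstay hPYoff hPYin hPYdiag hPYout hPYstay hσ0 hσ1 hz hxt hyt
  have hgap_a : 0 ≤ xt (some a) - yt (some a) := by linarith [hdom a]
  have hgaps : 0 ≤ ∑ v ∈ univ.erase z, (xt (some v) - yt (some v)) * (1 - θ v) :=
    sum_nonneg fun v _ => mul_nonneg (by linarith [hdom v]) (by linarith [(hθm v).2])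
  have hez : 0 ≤ -((1 - θ z) * (yt (some z) - xt (some z))) := by
    have h1 : 0 ≤ 1 - θ z := by linarith [(hθm z).2]
    have h2 : yt (some z) - xt (some z) ≤ 0 := by linarith [hdom z]
    nlinarith [mul_nonneg h1 (neg_nonneg.mpr h2)]
  have hMC : ∑ v, θ v * (NC v : ℝ) ≤ K := by
    calc ∑ v, θ v * (NC v : ℝ) ≤ ∑ v, (NC v : ℝ) := sum_le_sum fun v _ =>
            mul_le_of_le_one_left (Nat.cast_nonneg _) (hθm v).2
      _ = K := by exact_mod_cast hNC
  have hMC0' : 0 ≤ ∑ v, θ v * (NC v : ℝ) := sum_nonneg fun v _ => mul_nonneg (by linarith [(hθm v).1]) (Nat.cast_nonneg _)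
  have hL0' : 0 ≤ L := by rw [hL, hM]; linarith only [hMC0', (hθm a).1, (hθm b).1, hK0r]
  have hL4 : L ≤ 4 * K + 2 := by rw [hL, hM]; linarith only [hMC, (hθm a).2, (hθm b).2]
  have hcost := tagged_costSide_loneBetween hW hp0 hp hθ hacc hK hNC hPXoff hPXin hPXdiag hPXout hPXstay hPYoff hPYin hPYdiag hPYout hPYstay
    hz1 hbz hza hbelow hx0 hxs hy0 hys hM hL0' hL4 hσ0 hσ1 hxt J
  have hMC0 : 0 ≤ ∑ v, θ v * (NC v : ℝ) := sum_nonneg fun v _ => mul_nonneg (by linarith [(hθm v).1]) (Nat.cast_nonneg _)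
  have hL0 : 0 ≤ L := by
    have hK0 : (0 : ℝ) ≤ K := Nat.cast_nonneg _
    rw [hL, hM]; nlinarith [(hθm a).1, (hθm b).1]
  have key : 0 ≤ L * (xt none + (xt (some a) - yt (some a)) - ∑ n ∈ range J, (1 - σ) * σ ^ n * max 0 (y (n + 1) (some z) - x (n + 1) (some z)))
      - (∑ v, xt (some v) * (1 - θ v) + xt none * (1 - θ a)) - (∑ v, yt (some v) * (1 - θ v) + yt none * (1 - θ b)) := by
    rw [hdec]
    have hga : 0 ≤ L * (xt (some a) - yt (some a)) := mul_nonneg hL0 hgap_a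
    linarith [hs3, hga, hgaps, hez, hcost]
  linarith

end LoneBetween

end Summit.Ventures.LatticeQCDFlow.Scaling
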